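import Summits.FinalStateConjecture.FinalStateConjecture.Theorems.PhotonSphereChannelsUniformPhotonSphereChannelsRKernelOneChannels

/-!
# Kernel-one far channels, X: the registered stub without the unused first-moment hypothesis

Line `crum-peeling-recessive-tower` of crux `UniformPhotonSphereChannelsR`
(stmt-FinalStateConjecture-14074).  The landed stub `stub_kernelOneChannels`
(`…RKernelOneChannels.lean`) carries the short-range hypothesis `IntegrableOn (fun x => x * Q x) (Ioi xf)`,
which its proof never uses (the incoming-flux decay of the original plan was replaced by a second
momentum identity on the triangle to the right of the vertical cut, `…RKernelOneWedge`).  This file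
records the same theorem WITHOUT that hypothesis, `stub_kernelOneChannelsNoMoment`, so that the
reshaped skeleton can drop the corresponding integrability clause from the hardest stub
`stub_residualSubHardy` (the peeled residual then only has to be shown nonnegative, non-increasing
and of Hardy size `≤ 1/16` beyond the log edge).  The proof is the landed assembly verbatim
(cutoff globalisation `…RKernelOneGlobalize`, `kernelOne_global`, static-mode comparison
`farLimit_sub_le`), minus the unused binder.
-/

noncomputable section

-- the doubled `FinalStateConjecture.FinalStateConjecture` path component trips dupNamespace
set_option linter.dupNamespace false

namespace Summit.FinalStateConjecture.FinalStateConjecture.Theorems.CrumPeelingRecessiveTower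

open Literature.Geometry.Lorentzian Literature.Geometry.Lorentzian.ReggeWheeler MeasureTheory Filter
open Set Topology Literature.Analysis.PDE Literature.Analysis.Calculus
open scoped ENNReal

/-- **Stub K′ — kernel-one far channels for a sub-Hardy potential, no first-moment hypothesis.**
For `Q ∈ C¹(a, ∞)`, `Q ≥ 0` on `(a, ∞)`, non-increasing on `[x_f, ∞)` with Hardy size
`t² Q(x_f + t) ≤ 1/16`, a finite-energy static solution `u` (`u'' = Qu` on `(a,∞)`, `u(x_f) ≠ 0`) and
a `C²` solution `φ` of `φ_tt − φ_xx + Qφ = 0` on the half-plane `{x > a}` with finite far energy at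
`t = 0`: `(1/2) · inf_c E_Q[φ − c u; x > x_f](0) ≤ E⁺_far + E⁻_far`.  Same proof as
`stub_kernelOneChannels`. -/
theorem stub_kernelOneChannelsNoMoment :
    ∀ (Q : ℝ → ℝ) (a xf : ℝ), a < xf → ContDiffOn ℝ 1 Q (Set.Ioi a) → (∀ x, a < x → 0 ≤ Q x) →
      AntitoneOn Q (Set.Ici xf) →
      (∀ t : ℝ, 0 < t → t ^ 2 * Q (xf + t) ≤ 1 / 16) →
      ∀ u : ℝ → ℝ, ContDiffOn ℝ 2 u (Set.Ioi a) →
        (∀ x, a < x → iteratedDeriv 2 u x = Q x * u x) →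
        (∫⁻ x in Set.Ioi xf, ENNReal.ofReal (deriv u x ^ 2 + Q x * u x ^ 2)) ≠ ⊤ → u xf ≠ 0 →
        ∀ φ : ℝ → ℝ → ℝ, ContDiffOn ℝ 2 (Function.uncurry φ) {z : ℝ × ℝ | a < z.2} →
          (∀ z : ℝ × ℝ, a < z.2 → IsSolutionAt Q φ z) → farEnergy Q xf φ 0 ≠ ⊤ →
          ENNReal.ofReal (1 / 2) *
              (⨅ c : ℝ, ∫⁻ x in Set.Ioi xf,
                ENNReal.ofReal (energyDensity Q (fun t y => φ t y - c * u y) 0 x))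
            ≤ farChannelEnergy Q xf φ atTop + farChannelEnergy Q xf φ atBot := by
  intro Q a xf hxf hQ1 hQ0 hQa hQK u hu2 hueq hufin huxf φ hφ2 hφsol hφfin
  -- the cutoff and the globalized potential
  obtain ⟨χ, a₁, a₂, ha₁, h12, h2f, hχ, hχ0, hχ1, hχnn⟩ := exists_cutoff hxf
  have ha₂ : a < a₂ := by linarith
  set V : ℝ → ℝ := fun x => χ x * Q x with hVdef
  have hVC : ContDiff ℝ 1 V := contDiff_cutoff_mul hχ hχ0 ha₁ hQ1
  have hVc : Continuous V := hVC.continuous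
  have hVQ : ∀ x, a₂ ≤ x → V x = Q x := fun x hx => by simp [hVdef, hχ1 x hx]
  have hV0 : ∀ x, 0 ≤ V x := by
    intro x
    rcases lt_or_ge a x with hx | hx
    · exact mul_nonneg (hχnn x) (hQ0 x hx)
    · simp [hVdef, hχ0 x (by linarith)]
  have hVa : AntitoneOn V (Ici xf) := by
    intro x hx y hy hxy
    have hx' : xf ≤ x := hx
    have hy' : xf ≤ y := hy
    rw [hVQ x (by linarith), hVQ y (by linarith)]
    exact hQa hx hy hxy
  have hVK : ∀ t : ℝ, 0 < t → t ^ 2 * V (xf + t) ≤ 1 / 16 := fun t ht => by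
    rw [hVQ (xf + t) (by linarith)]; exact hQK t ht
  -- the constant and the globalized functions
  set c₀ : ℝ := φ 0 xf / u xf with hc₀
  set φ₁ : ℝ → ℝ → ℝ := fun t y => φ t y - c₀ * u y with hφ₁
  set gS : ℝ → ℝ → ℝ := fun _ y => c₀ * u y with hgS
  set ψ : ℝ → ℝ → ℝ := fun t x => χ x * φ₁ t x with hψ
  set φg : ℝ → ℝ → ℝ := fun t x => χ x * φ t x with hφg
  set S : ℝ → ℝ → ℝ := fun t x => χ x * gS t x with hS
  have hψdef : ψ = fun t x => φg t x - S t x := by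
    funext t x; simp only [hψ, hφg, hS, hφ₁, hgS]; ring
  have hstat : ∀ t x, S t x = S 0 x := fun t x => rfl
  -- regularity and the equation on the half-plane `{x ≥ xf}`
  have hφ₁2 : ContDiffOn ℝ 2 (Function.uncurry φ₁) {z : ℝ × ℝ | a < z.2} :=
    contDiffOn_sub_static hφ2 hu2 c₀
  have hφ₁sol : ∀ z : ℝ × ℝ, a < z.2 → IsSolutionAt Q φ₁ z :=
    isSolutionAt_sub_static hφ2 hφsol hu2 hueq c₀
  have hgS2 : ContDiffOn ℝ 2 (Function.uncurry gS) {z : ℝ × ℝ | a < z.2} := contDiffOn_static hu2 c₀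
  have hgSsol : ∀ z : ℝ × ℝ, a < z.2 → IsSolutionAt Q gS z := isSolutionAt_static hueq c₀
  have hψC : ContDiff ℝ 2 (Function.uncurry ψ) := contDiff_glob hχ hχ0 ha₁ hφ₁2
  have hφgC : ContDiff ℝ 2 (Function.uncurry φg) := contDiff_glob hχ hχ0 ha₁ hφ2
  have hSC : ContDiff ℝ 2 (Function.uncurry S) := contDiff_glob hχ hχ0 ha₁ hgS2
  have hψsol : ∀ τ x, xf ≤ x →
      iteratedDeriv 2 (fun σ => ψ σ x) τ - iteratedDeriv 2 (ψ τ) x + V x * ψ τ x = 0 :=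
    fun τ x hx => glob_residual hχ1 (fun z hz => hφ₁sol z (ha₂.trans hz)) τ x (h2f.trans_le hx)
  have hφgsol : ∀ τ x, xf ≤ x →
      iteratedDeriv 2 (fun σ => φg σ x) τ - iteratedDeriv 2 (φg τ) x + V x * φg τ x = 0 :=
    fun τ x hx => glob_residual hχ1 (fun z hz => hφsol z (ha₂.trans hz)) τ x (h2f.trans_le hx)
  have hSsol : ∀ τ x, xf ≤ x →
      iteratedDeriv 2 (fun σ => S σ x) τ - iteratedDeriv 2 (S τ) x + V x * S τ x = 0 :=
    fun τ x hx => glob_residual hχ1 (fun z hz => hgSsol z (ha₂.trans hz)) τ x (h2f.trans_le hx)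
  -- energy densities on the far region
  have hψe : ∀ t x, a₂ < x → deriv (fun τ => ψ τ x) t ^ 2 + deriv (ψ t) x ^ 2 + V x * ψ t x ^ 2
      = energyDensity Q φ₁ t x := fun t x hx => glob_energyDensity hχ1 φ₁ t x hx
  have hφge : ∀ t x, a₂ < x → deriv (fun τ => φg τ x) t ^ 2 + deriv (φg t) x ^ 2 + V x * φg t x ^ 2
      = energyDensity Q φ t x := fun t x hx => glob_energyDensity hχ1 φ t x hx
  have hSe : ∀ t x, a₂ < x → deriv (fun τ => S τ x) t ^ 2 + deriv (S t) x ^ 2 + V x * S t x ^ 2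
      = c₀ ^ 2 * (deriv u x ^ 2 + Q x * u x ^ 2) := by
    intro t x hx
    rw [show deriv (fun τ => S τ x) t ^ 2 + deriv (S t) x ^ 2 + V x * S t x ^ 2
      = energyDensity Q gS t x from glob_energyDensity hχ1 gS t x hx]
    simp only [energyDensity, hgS, deriv_const, deriv_const_mul_field']
    ring
  -- finiteness of the initial far energies
  have hφgfin : ∫⁻ x in Ioi xf, ENNReal.ofReal
      (deriv (fun τ => φg τ x) 0 ^ 2 + deriv (φg 0) x ^ 2 + V x * φg 0 x ^ 2) < ⊤ := by
    have h : farEnergy Q xf φ 0 = ∫⁻ x in Ioi xf, ENNReal.ofReal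
        (deriv (fun τ => φg τ x) 0 ^ 2 + deriv (φg 0) x ^ 2 + V x * φg 0 x ^ 2) := by
      unfold farEnergy
      rw [show {x : ℝ | xf + |(0 : ℝ)| < x} = Ioi xf by ext x; simp]
      exact setLIntegral_congr_fun measurableSet_Ioi fun x hx => by
        rw [hφge 0 x (h2f.trans hx)]
    rw [← h]
    exact lt_top_iff_ne_top.2 hφfin
  have hSfin : ∫⁻ x in Ioi xf, ENNReal.ofReal
      (deriv (fun τ => S τ x) 0 ^ 2 + deriv (S 0) x ^ 2 + V x * S 0 x ^ 2) < ⊤ := by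
    have h : (∫⁻ x in Ioi xf, ENNReal.ofReal
        (deriv (fun τ => S τ x) 0 ^ 2 + deriv (S 0) x ^ 2 + V x * S 0 x ^ 2))
        = ENNReal.ofReal (c₀ ^ 2) * ∫⁻ x in Ioi xf, ENNReal.ofReal (deriv u x ^ 2 + Q x * u x ^ 2) := by
      rw [← lintegral_const_mul' _ _ ENNReal.ofReal_ne_top]
      exact setLIntegral_congr_fun measurableSet_Ioi fun x hx => by
        rw [hSe 0 x (h2f.trans hx), ENNReal.ofReal_mul (sq_nonneg _)]
    rw [h]
    exact ENNReal.mul_lt_top ENNReal.ofReal_lt_top (lt_top_iff_ne_top.2 hufin)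
  have hψfin := lintegral_energy_sub_lt_top (xf := xf) hVc hV0 hφgC hSC hψdef hφgfin hSfin
  -- limits of the far energies
  obtain ⟨Lp, Lm, -, -, -, -, hLp, hLm⟩ := wave1D_exists_farEnergy_limits hVc hV0
    (continuous_residual hVc hψC) hψC (fun t x => rfl) hψsol hψfin
  obtain ⟨Mp, Mm, hMp0, hMm0, -, -, hMp, hMm⟩ := wave1D_exists_farEnergy_limits hVc hV0
    (continuous_residual hVc hφgC) hφgC (fun t x => rfl) hφgsol hφgfin
  -- the kernel-one inequality for `ψ` and the comparison of the limits
  have hψ0 : ψ 0 xf = 0 := by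
    simp only [hψ, hφ₁, hc₀, hχ1 xf h2f.le, div_mul_cancel₀ _ huxf]
    ring
  have hmain := kernelOne_global hVC hV0 hVa hVK hψC hψsol hψfin hψ0 hLp hLm
  have hcp := farLimit_sub_le hVc hV0 hφgC hφgsol hφgfin hSC hSsol hSfin hstat hψdef
    tendsto_abs_atTop_atTop hLp hMp
  have hcm := farLimit_sub_le hVc hV0 hφgC hφgsol hφgfin hSC hSsol hSfin hstat hψdef
    tendsto_abs_atBot_atTop hLm hMm
  -- the initial energy of `ψ` is the `Q`-energy of `φ − c₀ u` beyond `xf`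
  set E0 : ℝ := ∫ x in Ioi xf, (deriv (fun τ => ψ τ x) 0 ^ 2 + deriv (ψ 0) x ^ 2 + V x * ψ 0 x ^ 2)
    with hE0
  have hE0' : ENNReal.ofReal E0 = ∫⁻ x in Ioi xf, ENNReal.ofReal
      (deriv (fun τ => ψ τ x) 0 ^ 2 + deriv (ψ 0) x ^ 2 + V x * ψ 0 x ^ 2) := by
    have h := (wave1D_farEnergy_integrableOn hVc hV0 (continuous_residual hVc hψC) hψC
      (fun t x => rfl) hψsol hψfin 0).2
    simpa using h
  have hinf : (⨅ c : ℝ, ∫⁻ x in Ioi xf,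
      ENNReal.ofReal (energyDensity Q (fun t y => φ t y - c * u y) 0 x)) ≤ ENNReal.ofReal E0 := by
    refine (iInf_le _ c₀).trans (le_of_eq ?_)
    rw [hE0']
    exact setLIntegral_congr_fun measurableSet_Ioi fun x hx => by rw [hψe 0 x (h2f.trans hx)]
  -- the far channel energies of `φ` are `ofReal` of the limits `Mp`, `Mm`
  have hfe : farEnergy Q xf φ = fun t => ENNReal.ofReal (∫ x in Ioi (xf + |t|),
      (deriv (fun τ => φg τ x) t ^ 2 + deriv (φg t) x ^ 2 + V x * φg t x ^ 2)) := by
    funext t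
    rw [(wave1D_farEnergy_integrableOn hVc hV0 (continuous_residual hVc hφgC) hφgC
      (fun t x => rfl) hφgsol hφgfin t).2]
    unfold farEnergy
    exact setLIntegral_congr_fun measurableSet_Ioi fun x hx => by
      have hx' : xf + |t| < x := hx
      rw [hφge t x (by linarith [abs_nonneg t])]
  have hcTop : farChannelEnergy Q xf φ atTop = ENNReal.ofReal Mp := by
    unfold farChannelEnergy; rw [hfe]
    exact ((ENNReal.continuous_ofReal.tendsto Mp).comp hMp).liminf_eq
  have hcBot : farChannelEnergy Q xf φ atBot = ENNReal.ofReal Mm := by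
    unfold farChannelEnergy; rw [hfe]
    exact ((ENNReal.continuous_ofReal.tendsto Mm).comp hMm).liminf_eq
  -- conclusion
  have hE0nn : 0 ≤ E0 := setIntegral_nonneg measurableSet_Ioi fun x _ =>
    wave1D_energyDensity_nonneg hV0 0 x
  have hfinal : E0 / 2 ≤ Mp + Mm := by linarith
  rw [hcTop, hcBot, ← ENNReal.ofReal_add hMp0 hMm0]
  calc ENNReal.ofReal (1 / 2) * (⨅ c : ℝ, ∫⁻ x in Ioi xf,
        ENNReal.ofReal (energyDensity Q (fun t y => φ t y - c * u y) 0 x))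
      ≤ ENNReal.ofReal (1 / 2) * ENNReal.ofReal E0 := by gcongr
    _ = ENNReal.ofReal (E0 / 2) := by rw [← ENNReal.ofReal_mul (by norm_num)]; ring_nf
    _ ≤ ENNReal.ofReal (Mp + Mm) := ENNReal.ofReal_le_ofReal hfinal


end Summit.FinalStateConjecture.FinalStateConjecture.Theorems.CrumPeelingRecessiveTower
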